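import Literature.Barriers.QuantumAdvantage.UncorrectedNoiseMachineRun
import HarnessLib

/-!
# The noisy-IQP simulating machine, VII: the output law of the sampler

Support file for the discharge of `bremnerMontanaroShepherd2017_thm4`
(`Literature/Barriers/QuantumAdvantage/UncorrectedNoise.lean`). The machine of
`UncorrectedNoiseMachineRun` samples exactly from the sequential procedure `Alg` of
Bremner–Montanaro–Shepherd 2017, §3.2, run on the machine's approximation `q'` with the dyadic
rounding `R_m`:

* `coefFn`/`qApprox`: the approximation `q' = Σ_{|S| ≤ ℓ} (coefInt(S)/D) χ_S`, `D = 4^N 4^P`;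
* `tVal_eq_sum_subsets`, **`tVal_mul_eq_scaleD_mul_prefixSum`**: the machine's integers are the
  scaled prefix sums `D · S_{y'}(q') / 2^{N−K}` (§3.1, the marginal formula);
* `decF`, **`sampleRun_eq_ofFn_runOut`**: the machine's recursion is the coin-driven run
  `runOut` of `UncorrectedNoiseSampling`; **`card_decF_false`**: its per-step coin counts are
  `2^m · R_m(branchWeight S_{y0} S_{y1})`;
* coins as blocks (`ublk`, a bijection; `map_ublk_uniform`), `map_runOut_uniform`
  (push-forward of uniform coins under a coin-driven run is `algPMF`), and
  **`outputPMF_sampler`**: `(sampler F ℓ P C R2 m₀).outputPMF id x = (algPMF (R_m) N q').map List.ofFn`.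

## References

* [BremnerMontanaroShepherd2017] M. J. Bremner, A. Montanaro, D. J. Shepherd, *Achieving quantum
  supremacy with sparse and noisy commuting quantum computations*, Quantum 1 (2017) 8, §3.1–3.2.
-/

namespace Literature.Barriers.QuantumAdvantage.NoisyIQPMachine

open Finset _root_.Computability Literature.Computability.Complexity Literature.Computability.Cryptography
open Literature.Probability.RandomGraphs.LowDegree (sgn walsh)

variable {N : ℕ}

/-! ### The machine's approximating function `q'` and the scaled prefix sums -/

section Approx

variable (ℓ P : ℕ) (C : ℕ → ℕ) (R2 : ℕ) (x : List Bool) (L : List (QGate iqpDiag N))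

/-- The scaling `D = 4^N 4^P` of the stored integers. [folklore] -/
noncomputable def scaleD (N P : ℕ) : ℝ := (2 : ℝ) ^ N * 2 ^ N * (2 ^ P * 2 ^ P)

/-- `D > 0`. [folklore] -/
theorem scaleD_pos (N P : ℕ) : 0 < scaleD N P := by unfold scaleD; positivity

/-- **The Walsh coefficients of the machine's approximation** `q'`: the stored integer over `D`
on the small subsets, `0` above degree `ℓ`. [cite: BremnerMontanaroShepherd2017, §3.1 (q̃ with coefficients (1−ε)^{|s|} p̂'(s) for |s| ≤ ℓ, 0 else)] -/
noncomputable def coefFn (S : Finset (Fin N)) : ℝ :=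
  if S.card ≤ ℓ then (coefInt P C R2 L (zOfInput N x) (indic S) : ℝ) / scaleD N P else 0

/-- **The machine's approximation** `q' = Σ_S coefFn S · χ_S`. [cite: BremnerMontanaroShepherd2017, §3.1 (the function q̃)] -/
noncomputable def qApprox : (Fin N → Bool) → ℝ := fourierFn (coefFn ℓ P C R2 x L)

/-- The indicator of the coded subset is the tuple shift. [folklore] -/
theorem indic_tupleSet (l : List ℕ) : indic (tupleSet N l) = tupleShift N l := by
  funext i
  simp only [indic, tupleShift]
  rw [decide_eq_decide]
  exact mem_tupleSet

/-- A character at a prefix function as a sign: `∏_{i∈S} sgn (g i) = (−1)^{#{i ∈ S | g i}}`. [folklore] -/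
theorem prod_sgn_eq_neg_one_pow (S : Finset (Fin N)) (g : Fin N → Bool) :
    ∏ i ∈ S, sgn (g i) = (-1) ^ (S.filter fun i => g i = true).card := by
  simp only [sgn]
  rw [Finset.prod_ite, Finset.prod_const_one, mul_one, Finset.prod_const]

/-- The signed coefficient of a subset at a prefix: `(−1)^{#{i ∈ S : y'[i] = 1}} · coefInt(S)`. [folklore] -/
def signedCoef (y' : List Bool) (S : Finset (Fin N)) : ℤ :=
  (-1) ^ (S.filter fun i : Fin N => y'.getD i.val false = true).card * coefInt P C R2 L (zOfInput N x) (indic S)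

/-- `S ⊆ {0, …, K−1}`. [folklore] -/
def Below (K : ℕ) (S : Finset (Fin N)) : Prop := ∀ i ∈ S, (i : ℕ) < K

/-- `Below` is decidable. [folklore] -/
instance Below.decidable (K : ℕ) (S : Finset (Fin N)) : Decidable (Below K S) := by unfold Below; infer_instance

/-- The contribution as a function of the coded subset (canonical tuples, short prefixes). [folklore] -/
theorem contrVal_eq (K : ℕ) (y' : List Bool) (hy : y'.length ≤ N) (c : ℕ) (hc : IsCanon N (baseDigits (N + 1) ℓ c)) :
    contrVal ℓ P C R2 x L K y' c =
      (if Below K (tupleSet N (baseDigits (N + 1) ℓ c)) then signedCoef P C R2 x L y' (tupleSet N (baseDigits (N + 1) ℓ c))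
      else 0) := by
  have hle : ∀ q ∈ baseDigits (N + 1) ℓ c, q ≤ N := fun q hq => le_of_mem_baseDigits_succ hq
  have hiff : (∀ p ∈ baseDigits (N + 1) ℓ c, p < K ∨ p = N) ↔ Below K (tupleSet N (baseDigits (N + 1) ℓ c)) :=
    forall_lt_or_blank_iff hle
  unfold contrVal
  by_cases h : ∀ p ∈ baseDigits (N + 1) ℓ c, p < K ∨ p = N
  · rw [if_pos h, if_pos (hiff.1 h), signedCoef, countP_marked_eq_card hc hle y' hy, indic_tupleSet, neg_one_pow_eq_pow_mod_two]
    rcases Nat.mod_two_eq_zero_or_one (((tupleSet N (baseDigits (N + 1) ℓ c)).filter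
      fun i : Fin N => y'.getD i.val false = true).card) with h0 | h0
    · rw [h0]; simp
    · rw [h0]; simp
  · rw [if_neg h, if_neg (fun h' => h (hiff.2 h'))]

/-- **The scaled prefix sum over subsets**: `T^{(K)}_{y'} = Σ_{|S| ≤ ℓ, S ⊆ [K]} (−1)^{#{i∈S : y'[i]=1}} coefInt(S)`.
[cite: BremnerMontanaroShepherd2017, §3.1 (S_y = 2^{n−k} Σ_{s ⊆ [k]} q̂(s)(−1)^{y·s})] -/
theorem tVal_eq_sum_subsets (K : ℕ) (y' : List Bool) (hy : y'.length ≤ N) :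
    tVal ℓ P C R2 x L K y' = ∑ S ∈ univ.filter (fun S : Finset (Fin N) => S.card ≤ ℓ),
      (if Below K S then signedCoef P C R2 x L y' S else 0) := by
  unfold tVal
  have hnd : ((List.range ((N + 1) ^ ℓ)).filter fun c => decide (IsCanon N (baseDigits (N + 1) ℓ c))).Nodup :=
    List.Nodup.filter _ (List.nodup_range)
  have hset : ((List.range ((N + 1) ^ ℓ)).filter fun c => decide (IsCanon N (baseDigits (N + 1) ℓ c))).toFinset =
      (Finset.range ((N + 1) ^ ℓ)).filter fun c => IsCanon N (baseDigits (N + 1) ℓ c) := by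
    ext c; simp
  rw [← List.sum_toFinset _ hnd, hset, Finset.sum_filter, ← sum_canonical_eq_sum_subsets N ℓ]
  refine Finset.sum_congr rfl fun c _ => ?_
  by_cases hc : IsCanon N (baseDigits (N + 1) ℓ c)
  · rw [if_pos hc, if_pos hc]; exact contrVal_eq ℓ P C R2 x L K y' hy c hc
  · rw [if_neg hc, if_neg hc]

/-- **Prefix sums of `q'` are the scaled machine integers**: for `K ≤ N` and `|y'| ≤ N`,
`T^{(K)}_{y'} · 2^{N−K} = D · S_{y'}(q')`. [cite: BremnerMontanaroShepherd2017, §3.1 (marginal formula)] -/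
theorem tVal_mul_eq_scaleD_mul_prefixSum (K : ℕ) (hK : K ≤ N) (y' : List Bool) (hy : y'.length ≤ N) :
    (tVal ℓ P C R2 x L K y' : ℝ) * 2 ^ (N - K) =
      scaleD N P * prefixSum (qApprox ℓ P C R2 x L) K (fun i => y'.getD i false) := by
  rw [qApprox, prefixSum_fourierFn hK, tVal_eq_sum_subsets ℓ P C R2 x L K y' hy]
  have hD := scaleD_pos N P
  rw [Int.cast_sum, Finset.sum_mul, Finset.mul_sum, Finset.mul_sum, Finset.sum_filter, Finset.sum_filter]
  refine Finset.sum_congr rfl fun S _ => ?_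
  have hb : (∀ i ∈ S, (i : ℕ) < K) ↔ Below K S := Iff.rfl
  by_cases h1 : S.card ≤ ℓ <;> by_cases h2 : Below K S
  · rw [if_pos h1, if_pos h2, if_pos (hb.2 h2), coefFn, if_pos h1, signedCoef, prod_sgn_eq_neg_one_pow]
    field_simp
    push_cast
    ring
  · rw [if_pos h1, if_neg h2, if_neg (fun h => h2 (hb.1 h))]; simp
  · rw [if_neg h1, if_pos (hb.2 h2), coefFn, if_neg h1]; simp
  · rw [if_neg h1, if_neg (fun h => h2 (hb.1 h))]

end Approx

end Literature.Barriers.QuantumAdvantage.NoisyIQPMachine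

namespace Literature.Barriers.QuantumAdvantage.NoisyIQPMachine

open Finset _root_.Computability Literature.Computability.Complexity Literature.Computability.Cryptography

variable {N : ℕ}

/-! ### The run as a coin-driven sequential sampler (`UncorrectedNoiseSampling.iterOut`) -/

section Law

variable (ℓ P : ℕ) (C : ℕ → ℕ) (R2 : ℕ) (x : List Bool) (L : List (QGate iqpDiag N)) (m : ℕ)

/-- The machine's decision rule in the format of `iterOut`: bit `k` from the prefix function and
the coin block. [cite: BremnerMontanaroShepherd2017, §3.2 (steps 2(a)–(b))] -/
noncomputable def decF (k : ℕ) (g : ℕ → Bool) (blk : Fin m → Bool) : Bool :=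
  decBit m (tVal ℓ P C R2 x L (k + 1) (List.ofFn (fun i : Fin k => g i) ++ [false]))
    (tVal ℓ P C R2 x L (k + 1) (List.ofFn (fun i : Fin k => g i) ++ [true])) (bitsToNat (List.ofFn blk))

/-- **The machine's recursion is the coin-driven run**: with coin blocks `ublk` matching the
block values of `r`, `sampleRun … k` lists the prefix `iterOut (decF …) k`. [folklore] -/
theorem sampleRun_eq_ofFn_iterOut (r : List Bool) (ublk : Fin N → Fin m → Bool)
    (hblk : ∀ j : Fin N, blockVal r m j = bitsToNat (List.ofFn (ublk j))) :
    ∀ k : ℕ, k ≤ N → sampleRun ℓ P C R2 x L r m k =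
      List.ofFn (fun i : Fin k => iterOut (decF ℓ P C R2 x L m) (extC ublk) k i)
  | 0, _ => by simp [sampleRun]
  | k + 1, hk => by
    have ih := sampleRun_eq_ofFn_iterOut r ublk hblk k (by omega)
    rw [sampleRun, ih, List.ofFn_succ', List.concat_eq_append]
    have hA : (List.ofFn fun i : Fin k => iterOut (decF ℓ P C R2 x L m) (extC ublk) k i) =
        List.ofFn fun i : Fin k => iterOut (decF ℓ P C R2 x L m) (extC ublk) (k + 1) (Fin.castSucc i) := by
      refine congrArg List.ofFn (funext fun i => ?_)
      rw [Fin.val_castSucc, iterOut, Function.update_of_ne (by have := i.2; omega)]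
    have hB : decBit m (tVal ℓ P C R2 x L (k + 1) ((List.ofFn fun i : Fin k => iterOut (decF ℓ P C R2 x L m) (extC ublk) k i) ++ [false]))
        (tVal ℓ P C R2 x L (k + 1) ((List.ofFn fun i : Fin k => iterOut (decF ℓ P C R2 x L m) (extC ublk) k i) ++ [true]))
        (blockVal r m k) = iterOut (decF ℓ P C R2 x L m) (extC ublk) (k + 1) ((Fin.last k : Fin (k + 1)) : ℕ) := by
      have hk' : k < N := hk
      rw [Fin.val_last, iterOut, Function.update_self, decF, hblk ⟨k, hk⟩]
      simp [extC, hk']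
    rw [← hA, ← hB]

/-- **The machine's output is `runOut`** of its decision rule. [folklore] -/
theorem sampleRun_eq_ofFn_runOut (r : List Bool) (ublk : Fin N → Fin m → Bool)
    (hblk : ∀ j : Fin N, blockVal r m j = bitsToNat (List.ofFn (ublk j))) :
    sampleRun ℓ P C R2 x L r m N = List.ofFn (runOut (decF ℓ P C R2 x L m) N ublk) :=
  sampleRun_eq_ofFn_iterOut ℓ P C R2 x L m r ublk hblk N le_rfl

/-- The extended prefix of `ofFn g↾k ++ [b]` is `g` updated at `k`, below `k + 1`. [folklore] -/
theorem getD_ofFn_append (k : ℕ) (g : ℕ → Bool) (b : Bool) (i : ℕ) (hi : i < k + 1) :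
    (List.ofFn (fun j : Fin k => g j) ++ [b]).getD i false = Function.update g k b i := by
  rcases Nat.lt_succ_iff_lt_or_eq.1 hi with h | rfl
  · rw [List.getD_eq_getElem?_getD, List.getElem?_append_left (by simpa using h), Function.update_of_ne h.ne]
    simp [h]
  · rw [Function.update_self, List.getD_eq_getElem?_getD, List.getElem?_append_right (by simp)]
    simp

/-- **The count hypothesis of `card_runOut_div_eq_algR`**: at every step and prefix, the rule
appends `0` on exactly `2^m · R_m(branchWeight S_{y0} S_{y1})` of the coin blocks, `S` the prefix
sums of the machine's approximation `q'`. [cite: BremnerMontanaroShepherd2017, §3.2 (step 2(b))] -/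
theorem card_decF_false (k : ℕ) (hk : k < N) (g : ℕ → Bool) :
    (((univ : Finset (Fin m → Bool)).filter fun blk => decF ℓ P C R2 x L m k g blk = false).card : ℝ) =
      Fintype.card (Fin m → Bool) * stepWeight (roundUp m) (qApprox ℓ P C R2 x L) k g := by
  set t0 := tVal ℓ P C R2 x L (k + 1) (List.ofFn (fun i : Fin k => g i) ++ [false]) with ht0
  set t1 := tVal ℓ P C R2 x L (k + 1) (List.ofFn (fun i : Fin k => g i) ++ [true]) with ht1
  have hcard : ((univ : Finset (Fin m → Bool)).filter fun blk => decF ℓ P C R2 x L m k g blk = false).card =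
      ⌈(2 : ℝ) ^ m * branchWeight t0 t1⌉₊ := by
    show ((univ : Finset (Fin m → Bool)).filter fun blk => decBit m t0 t1 (bitsToNat (List.ofFn blk)) = false).card = _
    exact (card_filter_blocks_eq m (fun u => decBit m t0 t1 u = false)).trans (card_decBit_false m t0 t1)
  rw [hcard, Fintype.card_fun, Fintype.card_bool, Fintype.card_fin, stepWeight, roundUp]
  push_cast
  rw [mul_div_cancel₀ _ (by positivity : (2 : ℝ) ^ m ≠ 0)]
  congr 2
  -- the two scaled sums are a common positive multiple of the prefix sums
  have hlen : ∀ b : Bool, (List.ofFn (fun i : Fin k => g i) ++ [b]).length ≤ N := by intro b; simp; omega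
  have hps : ∀ b : Bool, prefixSum (qApprox ℓ P C R2 x L) (k + 1) (fun i => (List.ofFn (fun j : Fin k => g j) ++ [b]).getD i false) =
      prefixSum (qApprox ℓ P C R2 x L) (k + 1) (Function.update g k b) := fun b =>
    prefixSum_congr _ _ (fun i hi => getD_ofFn_append k g b i hi)
  have h0 := tVal_mul_eq_scaleD_mul_prefixSum ℓ P C R2 x L (k + 1) hk _ (hlen false)
  have h1 := tVal_mul_eq_scaleD_mul_prefixSum ℓ P C R2 x L (k + 1) hk _ (hlen true)
  rw [hps] at h0 h1
  rw [← ht0] at h0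
  rw [← ht1] at h1
  have hpow : (0 : ℝ) < 2 ^ (N - (k + 1)) := by positivity
  have hD := scaleD_pos N P
  have e0 : (t0 : ℝ) = (scaleD N P / 2 ^ (N - (k + 1))) * prefixSum (qApprox ℓ P C R2 x L) (k + 1) (Function.update g k false) := by
    field_simp; linarith
  have e1 : (t1 : ℝ) = (scaleD N P / 2 ^ (N - (k + 1))) * prefixSum (qApprox ℓ P C R2 x L) (k + 1) (Function.update g k true) := by
    field_simp; linarith
  rw [e0, e1, branchWeight_mul (div_pos hD hpow)]

end Law

end Literature.Barriers.QuantumAdvantage.NoisyIQPMachine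

namespace Literature.Barriers.QuantumAdvantage.NoisyIQPMachine

open Finset _root_.Computability Literature.Computability.Complexity Literature.Computability.Cryptography

variable {N : ℕ}

/-! ### The coin string as blocks, and the output law -/

section Coins

variable (N m : ℕ)

/-- The coin string cut into `N` blocks of `m` coins. [folklore] -/
def ublk (r : List.Vector Bool (N * m)) : Fin N → Fin m → Bool := fun j i => r.toList.getD (j * m + i) false

/-- The block values of the string are the values of its blocks. [folklore] -/
theorem blockVal_eq_ublk (r : List.Vector Bool (N * m)) (j : Fin N) :
    blockVal r.toList m j = bitsToNat (List.ofFn (ublk N m r j)) := by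
  unfold blockVal
  congr 1
  have hlen : r.toList.length = N * m := r.toList_length
  have hj : (j : ℕ) * m + m ≤ N * m := by have := j.2; nlinarith
  apply List.ext_getElem
  · simp only [List.length_take, List.length_drop, hlen, List.length_ofFn]; omega
  · intro i h1 h2
    simp only [List.length_ofFn] at h2
    rw [List.getElem_take, List.getElem_drop, List.getElem_ofFn, ublk, List.getD_eq_getElem?_getD,
      List.getElem?_eq_getElem (by omega)]
    rfl

/-- Cutting into blocks is injective. [folklore] -/
theorem ublk_injective : Function.Injective (ublk N m) := by
  intro r r' h
  apply List.Vector.ext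
  intro p
  have hp := p.2
  have hm : 0 < m := Nat.pos_of_ne_zero (by rintro rfl; simp at hp)
  have hj : (p : ℕ) / m < N := by rwa [Nat.div_lt_iff_lt_mul hm]
  have hi : (p : ℕ) % m < m := Nat.mod_lt _ hm
  have := congrFun (congrFun h ⟨_, hj⟩) ⟨_, hi⟩
  simp only [ublk] at this
  rw [Nat.div_add_mod'] at this
  have h1 : (p : ℕ) < r.toList.length := by simp
  have h2 : (p : ℕ) < r'.toList.length := by simp
  rw [List.Vector.get_eq_get_toList, List.Vector.get_eq_get_toList]
  simp only [List.get_eq_getElem]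
  rw [List.getD_eq_getElem?_getD, List.getD_eq_getElem?_getD, List.getElem?_eq_getElem h1,
    List.getElem?_eq_getElem h2] at this
  simpa using this

/-- Cutting into blocks is a bijection. [folklore] -/
theorem ublk_bijective : Function.Bijective (ublk N m) := by
  rw [Fintype.bijective_iff_injective_and_card]
  refine ⟨ublk_injective N m, ?_⟩
  simp only [card_vector, Fintype.card_bool, Fintype.card_fun, Fintype.card_fin]
  rw [mul_comm, pow_mul]

/-- Uniform coins give uniform blocks. [folklore] -/
theorem map_ublk_uniform :
    (PMF.uniformOfFintype (List.Vector Bool (N * m))).map (ublk N m) = PMF.uniformOfFintype (Fin N → Fin m → Bool) := by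
  ext u
  obtain ⟨r, rfl⟩ := (ublk_bijective N m).2 u
  rw [Literature.Computability.QuantumComplexity.pmf_map_apply_of_injective _ (ublk_injective N m),
    PMF.uniformOfFintype_apply, PMF.uniformOfFintype_apply]
  congr 1
  exact_mod_cast ((Fintype.bijective_iff_injective_and_card _).1 (ublk_bijective N m)).2

end Coins

/-- **Push-forward of uniform coins under a coin-driven run is `algPMF`** (the law computed by
`card_runOut_div_eq_algR`). [folklore] -/
theorem map_runOut_uniform {C : Type} [Fintype C] [Nonempty C] [Inhabited C] {R : ℝ → ℝ} (hR : RoundingOK R)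
    (F : ℕ → (ℕ → Bool) → C → Bool) (q : (Fin N → Bool) → ℝ)
    (hF : ∀ k, k < N → ∀ y : ℕ → Bool,
      (((univ : Finset C).filter fun c => F k y c = false).card : ℝ) = Fintype.card C * stepWeight R q k y) :
    (PMF.uniformOfFintype (Fin N → C)).map (runOut F N) = algPMF hR N q := by
  classical
  apply PMF.ext
  intro a
  have hcount := card_runOut_div_eq_algR F q hF a
  rw [← ENNReal.toReal_eq_toReal_iff' (PMF.apply_ne_top _ _) (PMF.apply_ne_top _ _), toReal_algPMF_apply, ← hcount]
  rw [PMF.map_apply, tsum_fintype]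
  simp only [PMF.uniformOfFintype_apply]
  have hsum : ∑ u : Fin N → C, (if a = runOut F N u then ((Fintype.card (Fin N → C) : ENNReal))⁻¹ else 0) =
      (((univ : Finset (Fin N → C)).filter fun u => runOut F N u = a).card : ENNReal) * ((Fintype.card (Fin N → C) : ENNReal))⁻¹ := by
    simp only [Finset.sum_ite, Finset.sum_const_zero, add_zero, Finset.sum_const, nsmul_eq_mul]
    congr 2
    exact congrArg Finset.card (Finset.filter_congr (p := fun u => a = runOut F N u) (q := fun u => runOut F N u = a)
      fun u _ => eq_comm)
  rw [hsum, ENNReal.toReal_mul, ENNReal.toReal_natCast, ENNReal.toReal_inv, ENNReal.toReal_natCast, Fintype.card_fun,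
    Fintype.card_fin, Nat.cast_pow, div_eq_mul_inv]

section OutputLaw

variable (F : IQPFamily) (ℓ P : ℕ) (C : ℕ → ℕ) (R2 m₀ : ℕ)

/-- **The output law of the sampler**: on input `x` (`n = |x|`, `N = n + anc n`, `m = N + m₀`),
the sampler's output distribution is `algPMF (R_m) N q'` relabelled by `List.ofFn`, `q'` the
machine's approximation for the circuit `F.diag n` and input bits `x`.
[cite: BremnerMontanaroShepherd2017, §3.2 (Alg samples from the sequential procedure)] -/
theorem outputPMF_sampler (x : List Bool) :
    (sampler F ℓ P C R2 m₀).outputPMF id x =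
      (algPMF (roundingOK_roundUp (width F x.length + m₀)) (width F x.length)
        (qApprox ℓ P C R2 x (F.diag x.length).gates)).map List.ofFn := by
  set Nw := width F x.length with hNw
  set m := Nw + m₀ with hm
  have hrun : ∀ r : List.Vector Bool (Nw * m), (sampler F ℓ P C R2 m₀).run x r.toList =
      List.ofFn (runOut (decF ℓ P C R2 x (F.diag x.length).gates m) Nw (ublk Nw m r)) := by
    intro r
    show runFn F.toQCircuitFamily.descFn ℓ P C R2 m₀ (boolPair x r.toList) = _
    rw [runFn_apply]
    exact sampleRun_eq_ofFn_runOut ℓ P C R2 x _ m r.toList (ublk Nw m r) (blockVal_eq_ublk Nw m r)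
  show (PMF.uniformOfFintype (List.Vector Bool (Nw * m))).map (fun r => (sampler F ℓ P C R2 m₀).run x r.toList) = _
  rw [show (fun r : List.Vector Bool (Nw * m) => (sampler F ℓ P C R2 m₀).run x r.toList) =
      (List.ofFn ∘ runOut (decF ℓ P C R2 x (F.diag x.length).gates m) Nw) ∘ ublk Nw m from funext fun r => hrun r]
  rw [← PMF.map_comp, map_ublk_uniform, ← PMF.map_comp,
    map_runOut_uniform (roundingOK_roundUp m) _ _ (fun k hk g => card_decF_false ℓ P C R2 x _ m k hk g)]

end OutputLaw

end Literature.Barriers.QuantumAdvantage.NoisyIQPMachine
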